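import Summits.QuantumFields.YangMills.Theorems.BalabanUVNodesN16SlotKeyWitnesses
import Summits.QuantumFields.BalabanUV.T4Continuum.Support.NE7EtaMinimiserGaugeCovariance
import Summits.QuantumFields.BalabanUV.T4Continuum.Support.SmoothRefineBlocks
import HarnessLib

/-!
# Route «BalabanUVNodes» (K3⁷ `SpineGivenEndpointR13SepCoPH`, stmt-QuantumFields-20544), DAG node N16 = NE3, in-edge N07 → N16 — THE RE-KEYED N07 IN-EDGE
# (slot key (T9ˢ) ∧ (T8)) IS GAUGE-COVARIANT: it descends to the gauge quotient `sfClass d L N ε₁ 0 ∕ 𝒢_N` of the loose data, and whatever is proved or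
# refuted on a data set `D` holds on its gauge saturation `𝒢_N · D`

Cell `pub-ymgap`, width seat `pub-ymgap-dag-n16-w2` (director-ym №197 ∕ HUMAN RULING D-0149), generation 5, file 2 of this generation (file 1: `…N16SlotKeyFlatModuli` — the key is
free on the flat moduli `sfClass d L N 0 0`; (8) holds at the k-dependent radius).  `--kind proof --supports stmt-QuantumFields-20544 --as helper` (count-neutral).
`bears_on: R4∕N16 · edge N07 → N16`.  THEOREMS ONLY (0 `def`, 0 `sorry`, standard axioms); BY NAME over landed modules: [Balaban1985Averaging] (11)∕(45) gauge covariance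
of the iterated average (42)∕(43) for ARBITRARY site gauges (`B7Prop6Flat.avgIter_gaugeAct_units`, NO small-field regime), the cell `pub-balaban`'s
`NE7EtaMinimiserGaugeCovariance.levelAction_gaugeAct` ∕ `NE3ResidualSliceRep.mem_sfClass_gaugeAct`, its block map `SmoothRefineBlocks.blk`, leaf-06's `torusVP ∕ gaugeFactors ∕
gaugeInf`, and dag-n16-w1's shape `lipGauge` (file 3 p606617-lineage `…N16H7OfN07RecordSlot`).

THE POINT.  The slot key (dag-n16-w1 file 9 §1; DischargeTest v6∕v6L `stub_reg910Slot`) quantifies over ALL loose data `V ∈ sfClass d L N ε₁ 0`.  A coarse site gauge `v`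
(unitary, `N`-periodic) moves the datum `V ↦ V^v`; its BLOCK-CONSTANT EXTENSION `ṽ(y) := v(⌊y∕L^{k}⌋)` (unitary, `(N·L^{k})`-periodic, corner values `ṽ(L^{k}·w) = v(w)`) moves
level-`k` configurations, and:
* §2 `avgIter L (U^{ṽ}) k = (avgIter L U k)^{v}` (`avgIter_gaugeAct_blkGauge`); the admissible sets of `V` and `V^v` are exchanged by `ṽ` and `ṽ⁻¹` and the Wilson action is
  invariant, so ★ `isMinimiser_gaugeAct_blkGauge`: `U` minimises run `k` over `sfClass d L N e` at `V` ⟹ `U^{ṽ}` minimises it at `V^v` — for EVERY radius `e`, with NO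
  small-field regime (the cell's `NE7EtaMinimiserGaugeCovariance.isMinimiser_gaugeAct` carries `LevelSmall`; here B7's formal covariance of (42) is used instead);
  `exists_isMinimiser_gaugeAct_iff` ((T8)'s conclusion at `V` ⟺ at `V^v`).
* §3 the (9)_{β₀=1} data are gauge-invariant: `lipGauge d n (U^u) y K α₀ α₁ α₂ ↔ lipGauge d n U y K α₀ α₁ α₂` (compose the local gauge with `u⁻¹`), hence the admissible
  factors `gaugeFactors`, their infimum `Ψ = gaugeInf` and r2's `B11.Regularity (torusVP d L N (lipGauge d n) k) B₃ B₄ ε₁ · (y, K)` are the same at `U` and `U^u`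
  (`regularity_torusVP_lipGauge_gaugeAct_iff`); likewise the G-free PER-SITE data of dag-n16-w1 file 12's normal form (T9♭) (`perSite_gaugeAct_iff`).
* §4 ★★ THE KEY ON GAUGE SATURATIONS: if (T9ˢ) (at `lipGauge`), resp. the per-site (T9♭), resp. (T8), holds with the datum ranging over a set `D`, it holds with the datum
  ranging over `𝒢_N · D := {V₀^v | V₀ ∈ D, v unitary N-periodic}` (`reg910Slot_on_saturation`, `perSiteKey_on_saturation`, `exists8Min_on_saturation`,
  `slotKey_bundle_on_saturation`).  So node N07's content is a statement about GAUGE ORBITS of loose data: a prover may fix any convenient gauge of the datum, a disprover's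
  witness is an orbit, and partial inhabitants (file 1's flat moduli; any future sub-family) are automatically saturated.

* §5 (v1.1, APPENDED) ARBITRARY fine gauges: `isMinimiser_gaugeAct_corner` — the cell's `NE7EtaMinimiserGaugeCovariance.isMinimiser_gaugeAct` (datum moved by the corner values
  `uLev L u k`) WITHOUT its `LevelSmall` hypothesis, every radius and run length (B7 (45) for arbitrary gauges); `isMinimiser_gaugeAct_of_cornerTrivial'` likewise.

HONEST FRAMING.  Kernel bookkeeping of gauge covariance over landed lemmas; nothing of Bałaban asserted or refuted; the content of the in-edge (non-flat loose orbits at a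
k-uniform `B₃` = [Balaban1985Variational] Thm 1 (8)–(10) p. 279 at the (42)-objects) untouched; `stub_h7` ∕ `stub_reg910Slot` ∕ `stub_lettersB9Src` NOT closed; no registered
stub of K3⁷ v5 named or closed; N16 ∕ N07 ∕ N19 NOT discharged; count-neutral; counts of record unmoved (typed 28∕28 · discharged 5∕28); one finite four-torus at fixed `ε`,
Bałaban AS PRINTED — NOT ℝ⁴, NOT infinite volume, NOT OS, NOT a mass gap; the YM mass gap (Clay) is NOT proved by any of this — R4 closes the conditional finite-𝕋⁴ rung
`BalabanLadder.UV` only.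
-/

set_option autoImplicit false

open scoped BigOperators Matrix Matrix.Norms.L2Operator
open NormedSpace

namespace Summit.QuantumFields.YangMills.BalabanUVNodes.N16SlotKeyGaugeQuotient

open Literature.MathematicalPhysics.QuantumFieldTheory.Balaban1983to89
open B7Prop1Explicit B7Prop2Explicit MatrixLog UnitaryModel
open T4AveragingDeficitWall hiding Site Plane Plaq Bond
open T4AveragingDeficitWallBoundary (IsPeriodicCfg)
open B7AvgGaugeCovariance (uLev uLev_apply)
open B7Prop6Flat (avgIter_gaugeAct_units)
open Summit.QuantumFields.BalabanUV.T4Continuum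
open AveragingDeficitLatticeH2Prep (fd)
open AveragingDeficitKDatum (gaugeAct_inv_gaugeAct)
open MinimalActionLevels (levelAction)
open MinimalActionSandwich (IsMinimiser admissible)
open MinimalActionRate (sfClass)
open MinimalActionDictionary (torusVP RadiiMono gaugeFactors gaugeInf)
open NE3EnergyShapes (IsUnitarySite IsPeriodicSite)
open NE3ResidualSliceRep (mem_sfClass_gaugeAct)
open NE7EtaMinimiserGaugeCovariance (levelAction_gaugeAct isUnitarySite_inv isPeriodicSite_inv)
open SmoothRefineBlocks (blk blk_res_smul)
open B11 (Regularity)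
open Summit.QuantumFields.YangMills.BalabanUVNodes.N16H7OfN07RecordSlot (lipGauge radiiMono_lipGauge' interface_lipGauge')

noncomputable section

variable {d : ℕ} {n : Type} [Fintype n] [DecidableEq n]

/-! ## §1 Composition of gauges; the block-constant extension of a coarse site gauge -/

/-- Two successive gauge transformations are one by the pointwise product: `(U^u)^w = U^{w·u}` ((8) of [Balaban1985Averaging]). [folklore] -/
theorem gaugeAct_gaugeAct (w u : Site d → (Matrix n n ℂ)ˣ) (U : Site d → Fin d → (Matrix n n ℂ)ˣ) :
    gaugeAct w (gaugeAct u U) = gaugeAct (w * u) U := by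
  funext x μ
  simp only [gaugeAct, Pi.mul_apply, mul_inv_rev, mul_assoc]

/-- Undoing `u` after `u`: `(U^u)^{w·u⁻¹} = U^w`. [folklore] -/
theorem gaugeAct_mul_inv_gaugeAct (w u : Site d → (Matrix n n ℂ)ˣ) (U : Site d → Fin d → (Matrix n n ℂ)ˣ) :
    gaugeAct (fun z => w z * (u z)⁻¹) (gaugeAct u U) = gaugeAct w U := by
  rw [gaugeAct_gaugeAct]
  congr 1
  funext z
  simp only [Pi.mul_apply, inv_mul_cancel_right]

/-- The block map under a shift by `t` blocks in direction `i`: `⌊(y + M·t·e_i)∕M⌋ = ⌊y∕M⌋ + t·e_i` (`M ≥ 1`). [folklore] -/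
theorem blk_add_mul_smul_e {M : ℕ} (hM : 1 ≤ M) (y : Site d) (t : ℤ) (i : Fin d) :
    blk M (y + ((M : ℤ) * t) • e i) = blk M y + t • e i := by
  ext j
  have hM0 : (M : ℤ) ≠ 0 := by exact_mod_cast (show M ≠ 0 by omega)
  simp only [blk, Pi.add_apply, Pi.smul_apply, smul_eq_mul, e_apply]
  split_ifs with h
  · rw [mul_one, mul_one, mul_comm, Int.add_mul_ediv_right _ _ hM0]
  · rw [mul_zero, mul_zero, add_zero, add_zero]

/-- **CORNER VALUES OF THE BLOCK-CONSTANT EXTENSION**: `ṽ(M·w) = v(w)` for `ṽ := v ∘ ⌊·∕M⌋` (`M ≥ 1`). [folklore] -/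
theorem blkGauge_corner {M : ℕ} (hM : 1 ≤ M) (v : Site d → (Matrix n n ℂ)ˣ) (w : Site d) : v (blk M ((M : ℤ) • w)) = v w := by
  rw [(blk_res_smul hM w).1]

/-- The corner values read by the `k`-fold average: `uLev L ṽ k = v` for `ṽ := v ∘ ⌊·∕L^k⌋` (`L ≥ 1`). [folklore] -/
theorem uLev_blkGauge {L : ℕ} (hL : 1 ≤ L) (v : Site d → (Matrix n n ℂ)ˣ) (k : ℕ) :
    uLev L (fun y => v (blk (L ^ k) y)) k = v := by
  funext w
  have hM : 1 ≤ L ^ k := Nat.one_le_pow _ _ hL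
  rw [uLev_apply]
  have hc : ((L : ℤ) ^ k) = ((L ^ k : ℕ) : ℤ) := by push_cast; rfl
  rw [hc]
  exact blkGauge_corner hM v w

/-- The extension of a unitary site gauge is unitary. [folklore] -/
theorem isUnitarySite_blkGauge (M : ℕ) {v : Site d → (Matrix n n ℂ)ˣ} (hv : IsUnitarySite v) : IsUnitarySite fun y => v (blk M y) :=
  fun y => hv (blk M y)

/-- The extension of an `N`-periodic site gauge is `(N·M)`-periodic (`M ≥ 1`). [folklore] -/
theorem isPeriodicSite_blkGauge {M : ℕ} (hM : 1 ≤ M) {N : ℕ} {v : Site d → (Matrix n n ℂ)ˣ} (hv : IsPeriodicSite v (N : ℤ)) :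
    IsPeriodicSite (fun y => v (blk M y)) ((N * M : ℕ) : ℤ) := by
  intro x i
  show v (blk M (x + ((N * M : ℕ) : ℤ) • e i)) = v (blk M x)
  have e1 : ((N * M : ℕ) : ℤ) = (M : ℤ) * (N : ℤ) := by push_cast; ring
  rw [e1, blk_add_mul_smul_e hM, hv]

/-! ## §2 The iterated average and the variational problem under a coarse gauge change (no small-field regime) -/

/-- **(45) AT THE `k`-FOLD AVERAGE, FOR THE EXTENSION**: `avgIter L (U^{ṽ}) k = (avgIter L U k)^{v}` — [Balaban1985Averaging]'s gauge covariance (11) of (42)∕(43) for arbitrary site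
gauges (`B7Prop6Flat.avgIter_gaugeAct_units`: the datum moves by the corner values `uLev L ṽ k = v`).  `L ≥ 1`. [cite: Balaban1985Averaging, (11) p.19, (45) p.24] -/
theorem avgIter_gaugeAct_blkGauge {L : ℕ} (hL : 1 ≤ L) (v : Site d → (Matrix n n ℂ)ˣ) (U : Site d → Fin d → (Matrix n n ℂ)ˣ) (k : ℕ) :
    avgIter L (gaugeAct (fun y => v (blk (L ^ k) y)) U) k = gaugeAct v (avgIter L U k) := by
  rw [avgIter_gaugeAct_units, uLev_blkGauge hL]

/-- **ADMISSIBILITY MOVES WITH THE DATUM**: `U ∈ admissible (sfClass d L N e) L k V`, `v` unitary `N`-periodic ⟹ `U^{ṽ} ∈ admissible (sfClass d L N e) L k (V^v)` (class invariance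
`NE3ResidualSliceRep.mem_sfClass_gaugeAct` at the `(N·L^k)`-periodic unitary `ṽ`, and §2's covariance).  Every radius `e`, `L ≥ 1`. [folklore] -/
theorem mem_admissible_gaugeAct_blkGauge [Nonempty n] {L N : ℕ} (hL : 1 ≤ L) {e : ℝ} {k : ℕ} {V U : Site d → Fin d → (Matrix n n ℂ)ˣ}
    (hU : U ∈ admissible (sfClass d L N e) L k V) {v : Site d → (Matrix n n ℂ)ˣ} (hv : IsUnitarySite v) (hvP : IsPeriodicSite v (N : ℤ)) :
    gaugeAct (fun y => v (blk (L ^ k) y)) U ∈ admissible (sfClass d L N e) L k (gaugeAct v V) := by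
  refine ⟨mem_sfClass_gaugeAct (isUnitarySite_blkGauge _ hv) (isPeriodicSite_blkGauge (Nat.one_le_pow _ _ hL) hvP) hU.1, ?_⟩
  rw [avgIter_gaugeAct_blkGauge hL, hU.2]

/-- **★ MINIMISERS MOVE WITH THE DATUM — NO SMALL-FIELD REGIME**: if `U` minimises run `k` of the Wilson action over `sfClass d L N e` at `V` then, for every unitary `N`-periodic coarse
site gauge `v`, `U^{ṽ}` minimises it at `V^v` (`ṽ = v ∘ ⌊·∕L^k⌋`): the admissible sets of `V` and `V^v` are exchanged by `ṽ` and `ṽ⁻¹ = (v⁻¹)~` and the level action is gauge invariant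
(`NE7EtaMinimiserGaugeCovariance.levelAction_gaugeAct`).  Every radius `e`, `L ≥ 1`; compare the cell's `isMinimiser_gaugeAct` (same statement for general fine gauges under
`LevelSmall`). [folklore] -/
theorem isMinimiser_gaugeAct_blkGauge [Nonempty n] {L N : ℕ} (hL : 1 ≤ L) {e : ℝ} {k : ℕ} {V U : Site d → Fin d → (Matrix n n ℂ)ˣ}
    (hU : IsMinimiser d (sfClass d L N e) L N k V U) {v : Site d → (Matrix n n ℂ)ˣ} (hv : IsUnitarySite v) (hvP : IsPeriodicSite v (N : ℤ)) :
    IsMinimiser d (sfClass d L N e) L N k (gaugeAct v V) (gaugeAct (fun y => v (blk (L ^ k) y)) U) := by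
  refine ⟨mem_admissible_gaugeAct_blkGauge hL hU.mem hv hvP, fun U' hU' => ?_⟩
  -- pull the competitor back to the datum `V` with the extension of `v⁻¹`
  have hback := mem_admissible_gaugeAct_blkGauge hL hU' (isUnitarySite_inv hv) (isPeriodicSite_inv hvP)
  rw [gaugeAct_inv_gaugeAct] at hback
  have hle := hU.le _ hback
  rw [levelAction_gaugeAct] at hle
  rw [levelAction_gaugeAct]
  exact hle

/-- **(T8)'s CONCLUSION IS CONSTANT ON GAUGE ORBITS**: a minimiser of run `k` over `sfClass d L N e` exists at `V^v` iff one exists at `V` (`v` unitary `N`-periodic; every `e`; `L ≥ 1`).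
[folklore] -/
theorem exists_isMinimiser_gaugeAct_iff [Nonempty n] {L N : ℕ} (hL : 1 ≤ L) {e : ℝ} {k : ℕ} (V : Site d → Fin d → (Matrix n n ℂ)ˣ)
    {v : Site d → (Matrix n n ℂ)ˣ} (hv : IsUnitarySite v) (hvP : IsPeriodicSite v (N : ℤ)) :
    (∃ U, IsMinimiser d (sfClass d L N e) L N k (gaugeAct v V) U) ↔ ∃ U, IsMinimiser d (sfClass d L N e) L N k V U := by
  constructor
  · rintro ⟨U, hU⟩
    have h := isMinimiser_gaugeAct_blkGauge hL hU (isUnitarySite_inv hv) (isPeriodicSite_inv hvP)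
    rw [gaugeAct_inv_gaugeAct] at h
    exact ⟨_, h⟩
  · rintro ⟨U, hU⟩
    exact ⟨_, isMinimiser_gaugeAct_blkGauge hL hU hv hvP⟩

/-- The admissible set of `V^v` is non-empty iff that of `V` is (same exchange). [folklore] -/
theorem nonempty_admissible_gaugeAct_iff [Nonempty n] {L N : ℕ} (hL : 1 ≤ L) {e : ℝ} {k : ℕ} (V : Site d → Fin d → (Matrix n n ℂ)ˣ)
    {v : Site d → (Matrix n n ℂ)ˣ} (hv : IsUnitarySite v) (hvP : IsPeriodicSite v (N : ℤ)) :
    (admissible (sfClass d L N e) L k (gaugeAct v V)).Nonempty ↔ (admissible (sfClass d L N e) L k V).Nonempty := by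
  constructor
  · rintro ⟨U, hU⟩
    have h := mem_admissible_gaugeAct_blkGauge hL hU (isUnitarySite_inv hv) (isPeriodicSite_inv hvP)
    rw [gaugeAct_inv_gaugeAct] at h
    exact ⟨_, h⟩
  · rintro ⟨U, hU⟩
    exact ⟨_, mem_admissible_gaugeAct_blkGauge hL hU hv hvP⟩

/-! ## §3 The (9)_{β₀=1} data are gauge invariant: `lipGauge`, the admissible factors, `Ψ`, r2's `Regularity` for the torus instance; the per-site data -/

/-- **THE SUP SHAPE IS GAUGE INVARIANT (one direction)**: `lipGauge d n U y K α₀ α₁ α₂`, `u` unitary ⟹ `lipGauge d n (U^u) y K α₀ α₁ α₂` — gauge `U^u` by `w·u⁻¹` where `w` is the local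
gauge of `U`; the potential `a` is unchanged. [folklore] -/
theorem lipGauge_gaugeAct {u : Site d → (Matrix n n ℂ)ˣ} (hu : IsUnitarySite u) {U : Site d → Fin d → (Matrix n n ℂ)ˣ} {y : Site d} {K : ℕ} {α₀ α₁ α₂ : ℝ}
    (h : lipGauge d n U y K α₀ α₁ α₂) : lipGauge d n (gaugeAct u U) y K α₀ α₁ α₂ := by
  obtain ⟨w, a, hw, hexp, h0, h1, h2⟩ := h
  refine ⟨fun z => w z * (u z)⁻¹, a, fun z => (unitaryUnits (Matrix n n ℂ)).mul_mem (hw z) ((unitaryUnits (Matrix n n ℂ)).inv_mem (hu z)),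
    fun z τ hz => ?_, h0, h1, h2⟩
  rw [gaugeAct_mul_inv_gaugeAct]
  exact hexp z τ hz

/-- **THE SUP SHAPE IS GAUGE INVARIANT**: `lipGauge d n (U^u) y K α₀ α₁ α₂ ↔ lipGauge d n U y K α₀ α₁ α₂` for unitary `u` (back by `u⁻¹`). [folklore] -/
theorem lipGauge_gaugeAct_iff {u : Site d → (Matrix n n ℂ)ˣ} (hu : IsUnitarySite u) (U : Site d → Fin d → (Matrix n n ℂ)ˣ) (y : Site d) (K : ℕ) (α₀ α₁ α₂ : ℝ) :
    lipGauge d n (gaugeAct u U) y K α₀ α₁ α₂ ↔ lipGauge d n U y K α₀ α₁ α₂ := by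
  refine ⟨fun h => ?_, lipGauge_gaugeAct hu⟩
  have h' := lipGauge_gaugeAct (isUnitarySite_inv hu) h
  rwa [gaugeAct_inv_gaugeAct] at h'

/-- Hence the ADMISSIBLE COMMON FACTORS of leaf-06's regularity device are the same at `U` and `U^u`. [folklore] -/
theorem gaugeFactors_lipGauge_gaugeAct {u : Site d → (Matrix n n ℂ)ˣ} (hu : IsUnitarySite u) (L k : ℕ) (U : Site d → Fin d → (Matrix n n ℂ)ˣ) (y : Site d) (K : ℕ) :
    gaugeFactors (lipGauge d n) L k (gaugeAct u U) y K = gaugeFactors (lipGauge d n) L k U y K := by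
  ext t
  simp only [gaugeFactors, Set.mem_setOf_eq, lipGauge_gaugeAct_iff hu]

/-- … and so is their infimum `Ψ`. [folklore] -/
theorem gaugeInf_lipGauge_gaugeAct {u : Site d → (Matrix n n ℂ)ˣ} (hu : IsUnitarySite u) (L k : ℕ) (U : Site d → Fin d → (Matrix n n ℂ)ˣ) (y : Site d) (K : ℕ) :
    gaugeInf (lipGauge d n) L k (gaugeAct u U) y K = gaugeInf (lipGauge d n) L k U y K := by
  unfold gaugeInf
  rw [gaugeFactors_lipGauge_gaugeAct hu]

/-- **★ r2's `B11.Regularity` FOR THE TORUS INSTANCE AT THE SHAPE `lipGauge` IS GAUGE INVARIANT**: for unitary `u`, every cube `(y, K)` and all `B₃ B₄ ε₁`,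
`Regularity (torusVP d L N (lipGauge d n) k) B₃ B₄ ε₁ (U^u) (y, K) ↔ Regularity (torusVP d L N (lipGauge d n) k) B₃ B₄ ε₁ U (y, K)` — the instance reads `U` only through `Gauged` and
`Ψ` of the shape. [cite: Balaban1985Variational, Thm 1 (9)–(10) p.279] -/
theorem regularity_torusVP_lipGauge_gaugeAct_iff {u : Site d → (Matrix n n ℂ)ˣ} (hu : IsUnitarySite u) (L N k : ℕ) (B₃ B₄ ε₁ : ℝ)
    (U : Site d → Fin d → (Matrix n n ℂ)ˣ) (y : Site d) (K : ℕ) :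
    Regularity (torusVP d L N (lipGauge d n) k) B₃ B₄ ε₁ (gaugeAct u U) (y, K) ↔ Regularity (torusVP d L N (lipGauge d n) k) B₃ B₄ ε₁ U (y, K) := by
  unfold Regularity
  dsimp only [torusVP]
  rw [gaugeFactors_lipGauge_gaugeAct hu, gaugeInf_lipGauge_gaugeAct hu]

/-- **THE G-FREE PER-SITE (9)_{β₀=1} DATA ARE GAUGE INVARIANT (one direction)**: the per-site data of dag-n16-w1 file 12's normal form (T9♭) about `x` with radii `(α₀, α₁, α₂)` — a unitary
`w` and a potential `a` with `U^w = exp a` within `|·|₁ ≤ 2` of `x`, `‖a‖ ≤ α₀` there, `‖∇a‖ ≤ α₁` within `1`, `‖∇∇a(x)‖ ≤ α₂` — pass from `U` to `U^u` (`u` unitary) with the gauge `w·u⁻¹`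
and the same `a`. [folklore] -/
theorem perSite_gaugeAct {u : Site d → (Matrix n n ℂ)ˣ} (hu : IsUnitarySite u) {U : Site d → Fin d → (Matrix n n ℂ)ˣ} {x : Site d} {α₀ α₁ α₂ : ℝ}
    (h : ∃ (w : Site d → (Matrix n n ℂ)ˣ) (a : Site d → Fin d → Matrix n n ℂ),
      (∀ z, w z ∈ unitaryUnits (Matrix n n ℂ)) ∧
      (∀ (y : Site d) (τ : Fin d), l1 (y - x) ≤ 2 → ((gaugeAct w U y τ : (Matrix n n ℂ)ˣ) : Matrix n n ℂ) = exp (a y τ)) ∧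
      (∀ (y : Site d) (τ : Fin d), l1 (y - x) ≤ 2 → ‖a y τ‖ ≤ α₀) ∧
      (∀ (y : Site d) (τ i : Fin d), l1 (y - x) ≤ 1 → ‖fd i (fun z => a z τ) y‖ ≤ α₁) ∧
      (∀ (τ i l : Fin d), ‖fd i (fd l (fun z => a z τ)) x‖ ≤ α₂)) :
    ∃ (w : Site d → (Matrix n n ℂ)ˣ) (a : Site d → Fin d → Matrix n n ℂ),
      (∀ z, w z ∈ unitaryUnits (Matrix n n ℂ)) ∧
      (∀ (y : Site d) (τ : Fin d), l1 (y - x) ≤ 2 → ((gaugeAct w (gaugeAct u U) y τ : (Matrix n n ℂ)ˣ) : Matrix n n ℂ) = exp (a y τ)) ∧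
      (∀ (y : Site d) (τ : Fin d), l1 (y - x) ≤ 2 → ‖a y τ‖ ≤ α₀) ∧
      (∀ (y : Site d) (τ i : Fin d), l1 (y - x) ≤ 1 → ‖fd i (fun z => a z τ) y‖ ≤ α₁) ∧
      (∀ (τ i l : Fin d), ‖fd i (fd l (fun z => a z τ)) x‖ ≤ α₂) := by
  obtain ⟨w, a, hw, hexp, h0, h1, h2⟩ := h
  refine ⟨fun z => w z * (u z)⁻¹, a, fun z => (unitaryUnits (Matrix n n ℂ)).mul_mem (hw z) ((unitaryUnits (Matrix n n ℂ)).inv_mem (hu z)),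
    fun y τ hy => ?_, h0, h1, h2⟩
  rw [gaugeAct_mul_inv_gaugeAct]
  exact hexp y τ hy

/-- **THE PER-SITE DATA ARE GAUGE INVARIANT** (iff; back by `u⁻¹`). [folklore] -/
theorem perSite_gaugeAct_iff {u : Site d → (Matrix n n ℂ)ˣ} (hu : IsUnitarySite u) (U : Site d → Fin d → (Matrix n n ℂ)ˣ) (x : Site d) (α₀ α₁ α₂ : ℝ) :
    (∃ (w : Site d → (Matrix n n ℂ)ˣ) (a : Site d → Fin d → Matrix n n ℂ),
      (∀ z, w z ∈ unitaryUnits (Matrix n n ℂ)) ∧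
      (∀ (y : Site d) (τ : Fin d), l1 (y - x) ≤ 2 → ((gaugeAct w (gaugeAct u U) y τ : (Matrix n n ℂ)ˣ) : Matrix n n ℂ) = exp (a y τ)) ∧
      (∀ (y : Site d) (τ : Fin d), l1 (y - x) ≤ 2 → ‖a y τ‖ ≤ α₀) ∧
      (∀ (y : Site d) (τ i : Fin d), l1 (y - x) ≤ 1 → ‖fd i (fun z => a z τ) y‖ ≤ α₁) ∧
      (∀ (τ i l : Fin d), ‖fd i (fd l (fun z => a z τ)) x‖ ≤ α₂)) ↔
    (∃ (w : Site d → (Matrix n n ℂ)ˣ) (a : Site d → Fin d → Matrix n n ℂ),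
      (∀ z, w z ∈ unitaryUnits (Matrix n n ℂ)) ∧
      (∀ (y : Site d) (τ : Fin d), l1 (y - x) ≤ 2 → ((gaugeAct w U y τ : (Matrix n n ℂ)ˣ) : Matrix n n ℂ) = exp (a y τ)) ∧
      (∀ (y : Site d) (τ : Fin d), l1 (y - x) ≤ 2 → ‖a y τ‖ ≤ α₀) ∧
      (∀ (y : Site d) (τ i : Fin d), l1 (y - x) ≤ 1 → ‖fd i (fun z => a z τ) y‖ ≤ α₁) ∧
      (∀ (τ i l : Fin d), ‖fd i (fd l (fun z => a z τ)) x‖ ≤ α₂)) := by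
  refine ⟨fun h => ?_, perSite_gaugeAct hu⟩
  have h' := perSite_gaugeAct (U := gaugeAct u U) (isUnitarySite_inv hu) h
  rwa [gaugeAct_inv_gaugeAct] at h'

/-! ## §4 The slot key on gauge saturations: (T9ˢ) at `lipGauge`, the per-site (T9♭), (T8), and the binder bundle -/

/-- **★ (T9ˢ) AT THE SHAPE `lipGauge` PASSES TO THE GAUGE SATURATION OF THE DATA SET** (every `C : B11Thm1.Consts`; `L ≥ 1`): if the slot key's regularity clause holds with the datum
ranging over `D`, it holds with the datum ranging over `𝒢_N · D = {V₀^v | V₀ ∈ D, v unitary N-periodic}` — a minimiser `U` at `V₀^v` is `(U^{(v⁻¹)~})^{ṽ}` with `U^{(v⁻¹)~}` a minimiser at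
`V₀` (§2), and `Regularity` at `lipGauge` does not see the gauge (§3). [cite: Balaban1985Variational, Thm 1 (9)–(10) p.279] -/
theorem reg910Slot_on_saturation [Nonempty n] {L N : ℕ} (hL : 1 ≤ L) (C : B11Thm1.Consts) {D : Set (Site d → Fin d → (Matrix n n ℂ)ˣ)}
    (hR : ∀ (k : ℕ) (ε₁ : ℝ), 0 < ε₁ → ε₁ ≤ C.a₁ → ∀ (V U : Site d → Fin d → (Matrix n n ℂ)ˣ), V ∈ D →
      IsMinimiser d (sfClass d L N (C.B₃ * ε₁)) L N (k + 1) V U →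
        ∀ x : Site d, Regularity (torusVP d L N (lipGauge d n) (k + 1)) C.B₃ C.B₄ ε₁ U (x, L ^ (k + 1) - 1 + L ^ (k + 1) + 2)) :
    ∀ (k : ℕ) (ε₁ : ℝ), 0 < ε₁ → ε₁ ≤ C.a₁ → ∀ (V U : Site d → Fin d → (Matrix n n ℂ)ˣ),
      V ∈ {W | ∃ V₀ ∈ D, ∃ v : Site d → (Matrix n n ℂ)ˣ, IsUnitarySite v ∧ IsPeriodicSite v (N : ℤ) ∧ W = gaugeAct v V₀} →
      IsMinimiser d (sfClass d L N (C.B₃ * ε₁)) L N (k + 1) V U →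
        ∀ x : Site d, Regularity (torusVP d L N (lipGauge d n) (k + 1)) C.B₃ C.B₄ ε₁ U (x, L ^ (k + 1) - 1 + L ^ (k + 1) + 2) := by
  intro k ε₁ hε₁ hε₁a V U hV hU x
  obtain ⟨V₀, hV₀, v, hv, hvP, rfl⟩ := hV
  -- the minimiser pulled back to the datum `V₀`
  have hback := isMinimiser_gaugeAct_blkGauge hL hU (isUnitarySite_inv hv) (isPeriodicSite_inv hvP)
  rw [gaugeAct_inv_gaugeAct] at hback
  have hreg := hR k ε₁ hε₁ hε₁a V₀ _ hV₀ hback x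
  exact (regularity_torusVP_lipGauge_gaugeAct_iff (isUnitarySite_blkGauge (L ^ (k + 1)) (isUnitarySite_inv hv)) L N (k + 1) C.B₃ C.B₄ ε₁ U x _).mp hreg

/-- **★ THE G-FREE PER-SITE KEY (T9♭) PASSES TO THE GAUGE SATURATION** — dag-n16-w1 file 12's normal form of `∃ G, RadiiMono ∧ interface ∧ (T9ˢ)(G, C)` (`slotKey_iff_perSite`), with the datum
relativised to a set `D`: if it holds on `D` it holds on `𝒢_N · D` (§2 + `perSite_gaugeAct_iff`).  `L ≥ 1`. [cite: Balaban1985Variational, Thm 1 (9) p.279] -/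
theorem perSiteKey_on_saturation [Nonempty n] {L N : ℕ} (hL : 1 ≤ L) (C : B11Thm1.Consts) {D : Set (Site d → Fin d → (Matrix n n ℂ)ˣ)}
    (hP : ∀ (k : ℕ) (ε₁ : ℝ), 0 < ε₁ → ε₁ ≤ C.a₁ → ∀ (V U : Site d → Fin d → (Matrix n n ℂ)ˣ), V ∈ D →
      IsMinimiser d (sfClass d L N (C.B₃ * ε₁)) L N (k + 1) V U →
        ∀ x : Site d, ∃ t : ℝ, 0 ≤ t ∧ t < C.B₃ * MinimalActionDictionary.cubeM L (k + 1) (L ^ (k + 1) - 1 + L ^ (k + 1) + 2) * ε₁ ∧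
          ∃ (w : Site d → (Matrix n n ℂ)ˣ) (a : Site d → Fin d → Matrix n n ℂ),
            (∀ z, w z ∈ unitaryUnits (Matrix n n ℂ)) ∧
            (∀ (y : Site d) (τ : Fin d), l1 (y - x) ≤ 2 → ((gaugeAct w U y τ : (Matrix n n ℂ)ˣ) : Matrix n n ℂ) = exp (a y τ)) ∧
            (∀ (y : Site d) (τ : Fin d), l1 (y - x) ≤ 2 → ‖a y τ‖ ≤ t / (L : ℝ) ^ (k + 1)) ∧
            (∀ (y : Site d) (τ i : Fin d), l1 (y - x) ≤ 1 → ‖fd i (fun z => a z τ) y‖ ≤ t / ((L : ℝ) ^ (k + 1)) ^ 2) ∧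
            (∀ (τ i l : Fin d), ‖fd i (fd l (fun z => a z τ)) x‖ ≤ t / ((L : ℝ) ^ (k + 1)) ^ 3)) :
    ∀ (k : ℕ) (ε₁ : ℝ), 0 < ε₁ → ε₁ ≤ C.a₁ → ∀ (V U : Site d → Fin d → (Matrix n n ℂ)ˣ),
      V ∈ {W | ∃ V₀ ∈ D, ∃ v : Site d → (Matrix n n ℂ)ˣ, IsUnitarySite v ∧ IsPeriodicSite v (N : ℤ) ∧ W = gaugeAct v V₀} →
      IsMinimiser d (sfClass d L N (C.B₃ * ε₁)) L N (k + 1) V U →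
        ∀ x : Site d, ∃ t : ℝ, 0 ≤ t ∧ t < C.B₃ * MinimalActionDictionary.cubeM L (k + 1) (L ^ (k + 1) - 1 + L ^ (k + 1) + 2) * ε₁ ∧
          ∃ (w : Site d → (Matrix n n ℂ)ˣ) (a : Site d → Fin d → Matrix n n ℂ),
            (∀ z, w z ∈ unitaryUnits (Matrix n n ℂ)) ∧
            (∀ (y : Site d) (τ : Fin d), l1 (y - x) ≤ 2 → ((gaugeAct w U y τ : (Matrix n n ℂ)ˣ) : Matrix n n ℂ) = exp (a y τ)) ∧
            (∀ (y : Site d) (τ : Fin d), l1 (y - x) ≤ 2 → ‖a y τ‖ ≤ t / (L : ℝ) ^ (k + 1)) ∧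
            (∀ (y : Site d) (τ i : Fin d), l1 (y - x) ≤ 1 → ‖fd i (fun z => a z τ) y‖ ≤ t / ((L : ℝ) ^ (k + 1)) ^ 2) ∧
            (∀ (τ i l : Fin d), ‖fd i (fd l (fun z => a z τ)) x‖ ≤ t / ((L : ℝ) ^ (k + 1)) ^ 3) := by
  intro k ε₁ hε₁ hε₁a V U hV hU x
  obtain ⟨V₀, hV₀, v, hv, hvP, rfl⟩ := hV
  have hback := isMinimiser_gaugeAct_blkGauge hL hU (isUnitarySite_inv hv) (isPeriodicSite_inv hvP)
  rw [gaugeAct_inv_gaugeAct] at hback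
  obtain ⟨t, ht0, htlt, hdata⟩ := hP k ε₁ hε₁ hε₁a V₀ _ hV₀ hback x
  refine ⟨t, ht0, htlt, ?_⟩
  exact (perSite_gaugeAct_iff (isUnitarySite_blkGauge (L ^ (k + 1)) (isUnitarySite_inv hv)) U x _ _ _).mp hdata

/-- **(T8) PASSES TO THE GAUGE SATURATION**: if at every datum of `D` some (8)-class minimiser of run `k+1` exists, the same holds at every datum of `𝒢_N · D` (§2).  `L ≥ 1`.
[cite: Balaban1985Variational, Thm 1 (8) p.279] -/
theorem exists8Min_on_saturation [Nonempty n] {L N : ℕ} (hL : 1 ≤ L) (C : B11Thm1.Consts) {D : Set (Site d → Fin d → (Matrix n n ℂ)ˣ)}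
    (hE : ∀ (k : ℕ) (ε₁ : ℝ), 0 < ε₁ → ε₁ ≤ C.a₁ → ∀ V : Site d → Fin d → (Matrix n n ℂ)ˣ, V ∈ D →
      ∃ U : Site d → Fin d → (Matrix n n ℂ)ˣ, IsMinimiser d (sfClass d L N (C.B₃ * ε₁)) L N (k + 1) V U) :
    ∀ (k : ℕ) (ε₁ : ℝ), 0 < ε₁ → ε₁ ≤ C.a₁ → ∀ V : Site d → Fin d → (Matrix n n ℂ)ˣ,
      V ∈ {W | ∃ V₀ ∈ D, ∃ v : Site d → (Matrix n n ℂ)ˣ, IsUnitarySite v ∧ IsPeriodicSite v (N : ℤ) ∧ W = gaugeAct v V₀} →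
      ∃ U : Site d → Fin d → (Matrix n n ℂ)ˣ, IsMinimiser d (sfClass d L N (C.B₃ * ε₁)) L N (k + 1) V U := by
  intro k ε₁ hε₁ hε₁a V hV
  obtain ⟨V₀, hV₀, v, hv, hvP, rfl⟩ := hV
  obtain ⟨U₀, hU₀⟩ := hE k ε₁ hε₁ hε₁a V₀ hV₀
  exact ⟨_, isMinimiser_gaugeAct_blkGauge hL hU₀ hv hvP⟩

/-- **★★ THE RE-KEYED N07 IN-EDGE BUNDLE PASSES TO GAUGE SATURATIONS** (every `C : B11Thm1.Consts`; `L ≥ 1`): if (T9ˢ) at the shape `lipGauge` and (T8) hold with the datum ranging over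
`D`, then the whole binder bundle `(G, hGm, hG, (T9ˢ), (T8))` of dag-n16-e's ∕ dag-n16-w2's DischargeTest v6 ∕ v6L `stub_reg910Slot` is inhabited with the datum ranging over the gauge
saturation `𝒢_N · D` (by `G := lipGauge d n`).  So node N07's content is a statement about GAUGE ORBITS of loose data — `𝒢_N · sfClass d L N ε₁ 0 = sfClass d L N ε₁ 0`, and every
partial inhabitant (file 1's flat moduli, any future gauge-fixed sub-family) is automatically saturated. [folklore] -/
theorem slotKey_bundle_on_saturation [Nonempty n] {L N : ℕ} (hL : 1 ≤ L) (C : B11Thm1.Consts) {D : Set (Site d → Fin d → (Matrix n n ℂ)ˣ)}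
    (hR : ∀ (k : ℕ) (ε₁ : ℝ), 0 < ε₁ → ε₁ ≤ C.a₁ → ∀ (V U : Site d → Fin d → (Matrix n n ℂ)ˣ), V ∈ D →
      IsMinimiser d (sfClass d L N (C.B₃ * ε₁)) L N (k + 1) V U →
        ∀ x : Site d, Regularity (torusVP d L N (lipGauge d n) (k + 1)) C.B₃ C.B₄ ε₁ U (x, L ^ (k + 1) - 1 + L ^ (k + 1) + 2))
    (hE : ∀ (k : ℕ) (ε₁ : ℝ), 0 < ε₁ → ε₁ ≤ C.a₁ → ∀ V : Site d → Fin d → (Matrix n n ℂ)ˣ, V ∈ D →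
      ∃ U : Site d → Fin d → (Matrix n n ℂ)ˣ, IsMinimiser d (sfClass d L N (C.B₃ * ε₁)) L N (k + 1) V U) :
    ∃ G : (Site d → Fin d → (Matrix n n ℂ)ˣ) → Site d → ℕ → ℝ → ℝ → ℝ → Prop,
      RadiiMono d G ∧
      (∀ (U : Site d → Fin d → (Matrix n n ℂ)ˣ) (x : Site d) (K : ℕ) (α₀ α₁ α₂ : ℝ), 2 ≤ K → G U x K α₀ α₁ α₂ →
        ∃ (u : Site d → (Matrix n n ℂ)ˣ) (a : Site d → Fin d → Matrix n n ℂ),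
          (∀ z, u z ∈ unitaryUnits (Matrix n n ℂ)) ∧
          (∀ (y : Site d) (τ : Fin d), l1 (y - x) ≤ 2 → ((gaugeAct u U y τ : (Matrix n n ℂ)ˣ) : Matrix n n ℂ) = exp (a y τ)) ∧
          (∀ (y : Site d) (τ : Fin d), l1 (y - x) ≤ 2 → ‖a y τ‖ ≤ α₀) ∧
          (∀ (y : Site d) (τ i : Fin d), l1 (y - x) ≤ 1 → ‖fd i (fun z => a z τ) y‖ ≤ α₁) ∧
          (∀ (τ i l : Fin d), ‖fd i (fd l (fun z => a z τ)) x‖ ≤ α₂)) ∧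
      (∀ (k : ℕ) (ε₁ : ℝ), 0 < ε₁ → ε₁ ≤ C.a₁ → ∀ (V U : Site d → Fin d → (Matrix n n ℂ)ˣ),
        V ∈ {W | ∃ V₀ ∈ D, ∃ v : Site d → (Matrix n n ℂ)ˣ, IsUnitarySite v ∧ IsPeriodicSite v (N : ℤ) ∧ W = gaugeAct v V₀} →
        IsMinimiser d (sfClass d L N (C.B₃ * ε₁)) L N (k + 1) V U →
          ∀ x : Site d, Regularity (torusVP d L N G (k + 1)) C.B₃ C.B₄ ε₁ U (x, L ^ (k + 1) - 1 + L ^ (k + 1) + 2)) ∧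
      (∀ (k : ℕ) (ε₁ : ℝ), 0 < ε₁ → ε₁ ≤ C.a₁ → ∀ V : Site d → Fin d → (Matrix n n ℂ)ˣ,
        V ∈ {W | ∃ V₀ ∈ D, ∃ v : Site d → (Matrix n n ℂ)ˣ, IsUnitarySite v ∧ IsPeriodicSite v (N : ℤ) ∧ W = gaugeAct v V₀} →
        ∃ U : Site d → Fin d → (Matrix n n ℂ)ˣ, IsMinimiser d (sfClass d L N (C.B₃ * ε₁)) L N (k + 1) V U) :=
  ⟨lipGauge d n, radiiMono_lipGauge', fun U x K α₀ α₁ α₂ hK hG => interface_lipGauge' U x K α₀ α₁ α₂ hK hG,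
    reg910Slot_on_saturation hL C hR, exists8Min_on_saturation hL C hE⟩

/-! ## §5 (v1.1, appended) ARBITRARY fine gauges: the cell's `isMinimiser_gaugeAct` WITHOUT the `LevelSmall` regime

`NE7EtaMinimiserGaugeCovariance.isMinimiser_gaugeAct` (pub-balaban) moves a minimiser by an ARBITRARY unitary `(N·L^k)`-periodic fine gauge `u` (datum moved by the corner
values `uLev L u k`) under `LevelSmall` (via `cavgIter_gaugeAct`); the hypothesis is REMOVABLE by `B7Prop6Flat.avgIter_gaugeAct_units` ((45) for arbitrary gauges). -/

/-- Admissibility under an arbitrary unitary `(N·L^k)`-periodic fine gauge `u`: the datum moves by the corner values `uLev L u k`.  No regime. [cite: Balaban1985Averaging, (11) p.19, (45) p.24] -/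
theorem mem_admissible_gaugeAct_corner [Nonempty n] {L N : ℕ} {e : ℝ} {k : ℕ} {V U : Site d → Fin d → (Matrix n n ℂ)ˣ}
    (hU : U ∈ admissible (sfClass d L N e) L k V) {u : Site d → (Matrix n n ℂ)ˣ} (hu : IsUnitarySite u) (huP : IsPeriodicSite u ((N * L ^ k : ℕ) : ℤ)) :
    gaugeAct u U ∈ admissible (sfClass d L N e) L k (gaugeAct (uLev L u k) V) :=
  ⟨mem_sfClass_gaugeAct hu huP hU.1, by rw [avgIter_gaugeAct_units, hU.2]⟩

/-- Corner values of the pointwise inverse = pointwise inverse of the corner values. [folklore] -/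
theorem uLev_inv (L : ℕ) (u : Site d → (Matrix n n ℂ)ˣ) (k : ℕ) : uLev L (fun z => (u z)⁻¹) k = fun z => (uLev L u k z)⁻¹ := rfl
/-- **★ MINIMISERS ARE GAUGE-COVARIANT UNDER ARBITRARY FINE GAUGES — NO SMALL-FIELD REGIME**: if `U` minimises run `k` of the Wilson action over `sfClass d L N e` at `V`, then for
every unitary `(N·L^k)`-periodic site gauge `u`, `U^u` minimises it at `V^{ū}`, `ū = uLev L u k` (the cell's `isMinimiser_gaugeAct` with its `LevelSmall` hypothesis dropped; every
radius `e`, every `k`, any `L`). [folklore] -/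
theorem isMinimiser_gaugeAct_corner [Nonempty n] {L N : ℕ} {e : ℝ} {k : ℕ} {V U : Site d → Fin d → (Matrix n n ℂ)ˣ}
    (hU : IsMinimiser d (sfClass d L N e) L N k V U) {u : Site d → (Matrix n n ℂ)ˣ} (hu : IsUnitarySite u) (huP : IsPeriodicSite u ((N * L ^ k : ℕ) : ℤ)) :
    IsMinimiser d (sfClass d L N e) L N k (gaugeAct (uLev L u k) V) (gaugeAct u U) := by
  refine ⟨mem_admissible_gaugeAct_corner hU.mem hu huP, fun U' hU' => ?_⟩
  have hback := mem_admissible_gaugeAct_corner hU' (isUnitarySite_inv hu) (isPeriodicSite_inv huP)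
  rw [uLev_inv, gaugeAct_inv_gaugeAct] at hback
  have hle := hU.le _ hback
  rw [levelAction_gaugeAct] at hle
  rw [levelAction_gaugeAct]
  exact hle

/-- **CORNER-TRIVIAL GAUGES KEEP THE DATUM — NO REGIME** (the cell's `isMinimiser_gaugeAct_of_cornerTrivial` without `LevelSmall`). [folklore] -/
theorem isMinimiser_gaugeAct_of_cornerTrivial' [Nonempty n] {L N : ℕ} {e : ℝ} {k : ℕ} {V U : Site d → Fin d → (Matrix n n ℂ)ˣ}
    (hU : IsMinimiser d (sfClass d L N e) L N k V U) {u : Site d → (Matrix n n ℂ)ˣ} (hu : IsUnitarySite u) (huP : IsPeriodicSite u ((N * L ^ k : ℕ) : ℤ))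
    (hc : ∀ w : Site d, u (((L : ℤ) ^ k) • w) = 1) :
    IsMinimiser d (sfClass d L N e) L N k V (gaugeAct u U) := by
  have h := isMinimiser_gaugeAct_corner hU hu huP
  have h1 : uLev L u k = fun _ => (1 : (Matrix n n ℂ)ˣ) := funext fun w => hc w
  have h2 : gaugeAct (fun _ : Site d => (1 : (Matrix n n ℂ)ˣ)) V = V := by funext x μ; simp only [gaugeAct, one_mul, inv_one, mul_one]
  rw [h1, h2] at h
  exact h

end

end Summit.QuantumFields.YangMills.BalabanUVNodes.N16SlotKeyGaugeQuotient
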